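import Literature.Analysis.FluidPDE.FourierL2DuhamelStep
import HarnessLib

/-!
# One Duhamel step in the weighted-`L²` class: the time-integrated `X¹`/`X²`-type bounds

Seventh file of the weighted-`L²` Fourier-side construction of the local smooth solution of the
Navier–Stokes system with `H¹`-controlled lifespan (discharge of
`Literature.Analysis.FluidPDE.tao2011_fourier_local_existence`; Tao 2013, Thm. 5.4 (ii)+(iv)).
For two `L²`-continuous trajectories `p, q` on `ℝ³` the bilinear Duhamel integral
`J(t, ξ) = ∫₀ᵗ e^{-c‖ξ‖²(t-s)} N(p s, q s)(ξ) ds` is controlled (`FourierL2DuhamelStep`) by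
`Φ(ξ)² = ∫⁻_{(0,T]} φ_ξ(s)² ds`, `φ_ξ(s) = 4π·9·‖(M_p(s) ⋆ M_q(s))(ξ)‖`. Here the fixed-time
Sobolev bounds of that file are integrated in time (Tonelli in `(s, ξ)`, Cauchy–Schwarz in `s`):

* `lintegral_sq_weight_Phi_le` — **Tao's (bilinear-2) on the Fourier side**:
  `∫ ‖ξ‖² Φ(ξ)² dξ ≤ 2C_N²K₃² (A^{1/2} A' (T P)^{1/2} + A'^{1/2} A (T P')^{1/2})`, where
  `A ≥ sup_s ‖ρ M_p(s)‖₂²`, `P ≥ ∫₀ᵀ ‖ρ² M_p(s)‖₂² ds` (and primed for `q`) — the Fourier form of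
  `‖∇(uv)‖_{L²_t L²_x} ≲ T^{1/4} ‖u‖_{X¹} ‖v‖_{X¹}` (arXiv Lemma 23, (bilinear-2));
* `lintegral_fourth_weight_Phi_le` — the `X²` level:
  `∫ ‖ξ‖⁴ Φ² ≤ 8C_N²K₃² (B^{1/2} A' (T E)^{1/2} + B'^{1/2} A (T E')^{1/2})`, linear in the
  top-order quantities `B ≥ sup ‖ρ²M_p‖₂²`, `E ≥ ∫‖ρ³M_p‖₂²`;
* the consequences for the Duhamel integral of the tree (`FourierNS.duhamelIntegral`, clamped
  time): pointwise envelope bounds of its majorant (`majorant_duhamelIntegral_sq_le`,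
  `majorant_duhamelIntegral_sq_le_low`) and the weighted time-integral bound
  (`lintegral_majorant_duhamelIntegral_sq_le`) in terms of `Φ²`.

## References

* T. Tao, Anal. PDE 6 (2013) = arXiv:1108.1165, Lemma 2.1 = arXiv Lemma 23 ((energy-duh2),
  (bilinear-2)) and the proof of Thm. 5.1/5.4 (arXiv pp. 16, 18). [Tao2011]
-/

noncomputable section

open MeasureTheory Real Set Filter Function intervalIntegral
open scoped ENNReal NNReal
open _root_.Topology

namespace Literature.Analysis.FluidPDE.FourierNS

/-! ### Measurability in time of the weighted norms of a jointly measurable trajectory -/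

section TimeMeasurability

variable {ι : Type*} [Fintype ι]

/-- For a jointly measurable trajectory `p : ℝ → E → ℂ^ι` and a measurable weight `W`, the
weighted square moment `s ↦ ∫⁻ (W ∑ⱼ ‖p s η j‖ₑ)² dη` is measurable in time. [folklore] -/
theorem aemeasurable_lintegral_weight_majorant_sq {p : ℝ → EuclideanSpace ℝ ι → ι → ℂ}
    (hpj : AEStronglyMeasurable (uncurry p) (volume.prod volume))
    {W : EuclideanSpace ℝ ι → ℝ≥0∞} (hW : Measurable W) :
    AEMeasurable (fun s => ∫⁻ η, (W η * ∑ j, ‖p s η j‖ₑ) ^ 2) volume := by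
  have h : AEMeasurable (fun z : ℝ × EuclideanSpace ℝ ι => (W z.2 * ∑ j, ‖p z.1 z.2 j‖ₑ) ^ 2)
      (volume.prod volume) := by
    refine ((hW.comp_aemeasurable measurable_snd.aemeasurable).mul ?_).pow_const 2
    exact Finset.aemeasurable_fun_sum _ fun j _ =>
      ((continuous_apply j).comp_aestronglyMeasurable hpj).enorm
  exact h.lintegral_prod_right'

/-- Hence the weighted `L²` norm `s ↦ ‖W ∑ⱼ ‖p s ·j‖ₑ‖_{L²}` is measurable in time. [folklore] -/
theorem aemeasurable_eLpNorm_weight_majorant {p : ℝ → EuclideanSpace ℝ ι → ι → ℂ}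
    (hpj : AEStronglyMeasurable (uncurry p) (volume.prod volume))
    {W : EuclideanSpace ℝ ι → ℝ≥0∞} (hW : Measurable W) (μ : Measure ℝ) (hμ : μ ≤ volume) :
    AEMeasurable (fun s => eLpNorm (fun η => W η * ∑ j, ‖p s η j‖ₑ) 2 volume) μ := by
  have h := (aemeasurable_lintegral_weight_majorant_sq hpj hW).pow_const (1 / 2 : ℝ)
  refine (h.mono_measure hμ).congr (Eventually.of_forall fun s => ?_)
  exact lintegral_sq_rpow_half_eq_eLpNorm _ _

end TimeMeasurability

/-! ### Elementary `ℝ≥0∞` tools -/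

/-- **Cauchy–Schwarz in time**: `∫⁻_{(0,T]} b ≤ (T · P)^{1/2}` if `∫⁻_{(0,T]} b² ≤ P`. [folklore] -/
theorem setLIntegral_Ioc_le_rpow_half {b : ℝ → ℝ≥0∞} {T : ℝ} {P : ℝ≥0∞}
    (hb : AEMeasurable b (volume.restrict (Ioc 0 T))) (hP : ∫⁻ s in Ioc 0 T, b s ^ 2 ≤ P) :
    ∫⁻ s in Ioc 0 T, b s ≤ (ENNReal.ofReal T * P) ^ (1 / 2 : ℝ) := by
  have hroot : ∀ {x A : ℝ≥0∞}, x ^ 2 ≤ A → x ≤ A ^ (1 / 2 : ℝ) := fun {x A} h =>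
    calc x = (x ^ 2) ^ (1 / 2 : ℝ) := by rw [← ENNReal.rpow_natCast, ← ENNReal.rpow_mul]; norm_num
      _ ≤ A ^ (1 / 2 : ℝ) := ENNReal.rpow_le_rpow h (by norm_num)
  refine hroot ?_
  have h := sq_lintegral_mul_le (volume.restrict (Ioc 0 T)) hb aemeasurable_const (g := fun _ => 1)
  simp only [mul_one, one_pow, lintegral_const, Measure.restrict_apply MeasurableSet.univ, univ_inter,
    Real.volume_Ioc, sub_zero, one_mul] at h
  calc (∫⁻ s in Ioc 0 T, b s) ^ 2 ≤ (∫⁻ s in Ioc 0 T, b s ^ 2) * ENNReal.ofReal T := h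
    _ ≤ P * ENNReal.ofReal T := mul_le_mul' hP le_rfl
    _ = ENNReal.ofReal T * P := mul_comm _ _

/-! ### The time-integrated level-one bound (Tao's (bilinear-2), Fourier form) -/

section Integrated

variable {p q : ℝ → EuclideanSpace ℝ (Fin 3) → Fin 3 → ℂ} {T : ℝ}

/-- **Tao's (bilinear-2) on the Fourier side.** For `L²`-continuous, jointly measurable
trajectories `p, q` on `ℝ³` with all weighted square moments finite, and bounds
`A ≥ ‖ρM_p(s)‖₂²` on `[0,T]`, `P ≥ ∫₀ᵀ‖ρ²M_p(s)‖₂²` (primed for `q`),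

  `∫ ‖ξ‖² ∫⁻_{(0,T]} φ_ξ(s)² ds dξ ≤ 2C_N²K₃² (A^{1/2} A' (T·P)^{1/2} + A'^{1/2} A (T·P')^{1/2})`,

`φ_ξ(s) = C_N ‖(M_p(s) ⋆ M_q(s))(ξ)‖ₑ`, `C_N = 4π·9`: Tonelli, the symmetrised fixed-time bound
`lintegral_norm_mul_fconv_majorant_sq_le`, `a(s) ≤ A^{1/2}`, `a'(s)² ≤ A'` and Cauchy–Schwarz in
time `∫₀ᵀ b ≤ (T P)^{1/2}`. This is `‖∇(uv)‖_{L²_tL²_x} ≲ T^{1/4}‖u‖_{X¹}‖v‖_{X¹}` (arXiv Lemma 23,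
(bilinear-2)) for `u = 𝓕M_p`, `v = 𝓕M_q`, squared. [cite: Tao2011, Lemma 2.1 (arXiv Lemma 23)] -/
theorem lintegral_sq_weight_Phi_le
    (hpm : ∀ s, AEStronglyMeasurable (p s) volume) (hqm : ∀ s, AEStronglyMeasurable (q s) volume)
    (hpj : AEStronglyMeasurable (uncurry p) (volume.prod volume))
    (hqj : AEStronglyMeasurable (uncurry q) (volume.prod volume))
    (hp2 : ∀ s j, MemLp (p s · j) 2 volume) (hq2 : ∀ s j, MemLp (q s · j) 2 volume)
    (hpc : ∀ j s₀, Tendsto (fun s => eLpNorm ((p s · j) - (p s₀ · j)) 2 volume) (𝓝 s₀) (𝓝 0))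
    (hqc : ∀ j s₀, Tendsto (fun s => eLpNorm ((q s · j) - (q s₀ · j)) 2 volume) (𝓝 s₀) (𝓝 0))
    (hpw : ∀ s (k : ℕ) j, ∫⁻ η, (ENNReal.ofReal ((1 + ‖η‖) ^ k) * ‖p s η j‖ₑ) ^ 2 < ⊤)
    (hqw : ∀ s (k : ℕ) j, ∫⁻ η, (ENNReal.ofReal ((1 + ‖η‖) ^ k) * ‖q s η j‖ₑ) ^ 2 < ⊤)
    {A A' P P' : ℝ≥0∞}
    (hA : ∀ s ∈ Icc 0 T, eLpNorm (fun η : EuclideanSpace ℝ (Fin 3) =>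
      ENNReal.ofReal ‖η‖ * ∑ j, ‖p s η j‖ₑ) 2 volume ^ 2 ≤ A)
    (hA' : ∀ s ∈ Icc 0 T, eLpNorm (fun η : EuclideanSpace ℝ (Fin 3) =>
      ENNReal.ofReal ‖η‖ * ∑ j, ‖q s η j‖ₑ) 2 volume ^ 2 ≤ A')
    (hP : ∫⁻ s in Ioc 0 T, eLpNorm (fun η : EuclideanSpace ℝ (Fin 3) =>
      ENNReal.ofReal (‖η‖ ^ 2) * ∑ j, ‖p s η j‖ₑ) 2 volume ^ 2 ≤ P)
    (hP' : ∫⁻ s in Ioc 0 T, eLpNorm (fun η : EuclideanSpace ℝ (Fin 3) =>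
      ENNReal.ofReal (‖η‖ ^ 2) * ∑ j, ‖q s η j‖ₑ) 2 volume ^ 2 ≤ P') :
    ∫⁻ ξ, ENNReal.ofReal (‖ξ‖ ^ 2) * ∫⁻ s in Ioc 0 T, (ENNReal.ofReal (4 * π) *
        (Fintype.card (Fin 3) : ℝ≥0∞) ^ 2 * ‖fconv (fun η => ((∑ j, ‖p s η j‖ : ℝ) : ℂ))
          (fun η => ((∑ j, ‖q s η j‖ : ℝ) : ℂ)) ξ‖ₑ) ^ 2 ≤
      2 * (ENNReal.ofReal (4 * π) * (Fintype.card (Fin 3) : ℝ≥0∞) ^ 2) ^ 2 *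
        ((SNormLESNormFDerivOfEqConst ℂ (volume : Measure (EuclideanSpace ℝ (Fin 3))) 2 *
          ENNReal.ofReal (2 * π)) ^ (3 / 2 : ℝ)) ^ 2 *
        (A ^ (1 / 2 : ℝ) * A' * (ENNReal.ofReal T * P) ^ (1 / 2 : ℝ) +
          A' ^ (1 / 2 : ℝ) * A * (ENNReal.ofReal T * P') ^ (1 / 2 : ℝ)) := by
  set C : ℝ≥0∞ := ENNReal.ofReal (4 * π) * (Fintype.card (Fin 3) : ℝ≥0∞) ^ 2 with hC
  set K3 : ℝ≥0∞ := (SNormLESNormFDerivOfEqConst ℂ (volume : Measure (EuclideanSpace ℝ (Fin 3))) 2 *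
    ENNReal.ofReal (2 * π)) ^ (3 / 2 : ℝ) with hK3
  have hCtop : C ≠ ⊤ := ENNReal.mul_ne_top ENNReal.ofReal_ne_top (by simp)
  -- the weighted norms as functions of time
  set a : ℝ → ℝ≥0∞ := fun s => eLpNorm (fun η : EuclideanSpace ℝ (Fin 3) =>
    ENNReal.ofReal ‖η‖ * ∑ j, ‖p s η j‖ₑ) 2 volume with ha
  set b : ℝ → ℝ≥0∞ := fun s => eLpNorm (fun η : EuclideanSpace ℝ (Fin 3) =>
    ENNReal.ofReal (‖η‖ ^ 2) * ∑ j, ‖p s η j‖ₑ) 2 volume with hb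
  set a' : ℝ → ℝ≥0∞ := fun s => eLpNorm (fun η : EuclideanSpace ℝ (Fin 3) =>
    ENNReal.ofReal ‖η‖ * ∑ j, ‖q s η j‖ₑ) 2 volume with ha'
  set b' : ℝ → ℝ≥0∞ := fun s => eLpNorm (fun η : EuclideanSpace ℝ (Fin 3) =>
    ENNReal.ofReal (‖η‖ ^ 2) * ∑ j, ‖q s η j‖ₑ) 2 volume with hb'
  have hwρ : Measurable fun η : EuclideanSpace ℝ (Fin 3) => ENNReal.ofReal ‖η‖ :=
    (ENNReal.continuous_ofReal.comp continuous_norm).measurable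
  have hwρ2 : Measurable fun η : EuclideanSpace ℝ (Fin 3) => ENNReal.ofReal (‖η‖ ^ 2) :=
    (ENNReal.continuous_ofReal.comp (continuous_norm.pow 2)).measurable
  have hbm : AEMeasurable b (volume.restrict (Ioc 0 T)) :=
    aemeasurable_eLpNorm_weight_majorant hpj hwρ2 _ Measure.restrict_le_self
  have hbm' : AEMeasurable b' (volume.restrict (Ioc 0 T)) :=
    aemeasurable_eLpNorm_weight_majorant hqj hwρ2 _ Measure.restrict_le_self
  -- the integrand `(s, ξ) ↦ ρ² φ²`
  set φ : ℝ → EuclideanSpace ℝ (Fin 3) → ℝ≥0∞ := fun s ξ => C * ‖fconv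
    (fun η => ((∑ j, ‖p s η j‖ : ℝ) : ℂ)) (fun η => ((∑ j, ‖q s η j‖ : ℝ) : ℂ)) ξ‖ₑ with hφ
  have hφm : Measurable (uncurry φ) := measurable_phi hpm hqm hp2 hq2 hpc hqc C
  -- Step 1: Tonelli
  have hswap : ∫⁻ ξ, ENNReal.ofReal (‖ξ‖ ^ 2) * ∫⁻ s in Ioc 0 T, φ s ξ ^ 2 =
      ∫⁻ s in Ioc 0 T, ∫⁻ ξ, ENNReal.ofReal (‖ξ‖ ^ 2) * φ s ξ ^ 2 := by
    calc ∫⁻ ξ, ENNReal.ofReal (‖ξ‖ ^ 2) * ∫⁻ s in Ioc 0 T, φ s ξ ^ 2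
        = ∫⁻ ξ, ∫⁻ s in Ioc 0 T, ENNReal.ofReal (‖ξ‖ ^ 2) * φ s ξ ^ 2 :=
          lintegral_congr fun ξ => (lintegral_const_mul' _ _ ENNReal.ofReal_ne_top).symm
      _ = ∫⁻ s in Ioc 0 T, ∫⁻ ξ, ENNReal.ofReal (‖ξ‖ ^ 2) * φ s ξ ^ 2 := by
          refine lintegral_lintegral_swap ?_
          have h1 : Measurable fun z : EuclideanSpace ℝ (Fin 3) × ℝ =>
              ENNReal.ofReal (‖z.1‖ ^ 2) * φ z.2 z.1 ^ 2 :=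
            (hwρ2.comp measurable_fst).mul ((hφm.comp measurable_swap).pow_const 2)
          exact h1.aemeasurable
  -- Step 2: the fixed-time bound
  have hfix : ∀ s, ∫⁻ ξ, ENNReal.ofReal (‖ξ‖ ^ 2) * φ s ξ ^ 2 ≤
      C ^ 2 * (2 * K3 ^ 2 * (a s * b s * a' s ^ 2 + a' s * b' s * a s ^ 2)) := by
    intro s
    have h := lintegral_norm_mul_fconv_majorant_sq_le (hpm s) (hqm s) (hp2 s) (hq2 s) (hpw s) (hqw s)
    calc ∫⁻ ξ, ENNReal.ofReal (‖ξ‖ ^ 2) * φ s ξ ^ 2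
        = C ^ 2 * ∫⁻ ξ, (ENNReal.ofReal ‖ξ‖ * ‖fconv (fun η => ((∑ j, ‖p s η j‖ : ℝ) : ℂ))
            (fun η => ((∑ j, ‖q s η j‖ : ℝ) : ℂ)) ξ‖ₑ) ^ 2 := by
          rw [← lintegral_const_mul' _ _ (by simp [hCtop])]
          refine lintegral_congr fun ξ => ?_
          rw [hφ]; simp only
          rw [ENNReal.ofReal_pow (norm_nonneg _)]; ring
      _ ≤ C ^ 2 * (2 * K3 ^ 2 * (a s * b s * a' s ^ 2 + a' s * b' s * a s ^ 2)) :=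
          mul_le_mul' le_rfl h
  -- Step 3: integrate in time
  have hroot : ∀ {x A : ℝ≥0∞}, x ^ 2 ≤ A → x ≤ A ^ (1 / 2 : ℝ) := fun {x A} h =>
    calc x = (x ^ 2) ^ (1 / 2 : ℝ) := by rw [← ENNReal.rpow_natCast, ← ENNReal.rpow_mul]; norm_num
      _ ≤ A ^ (1 / 2 : ℝ) := ENNReal.rpow_le_rpow h (by norm_num)
  have hIa : ∀ s ∈ Ioc 0 T, a s ≤ A ^ (1 / 2 : ℝ) := fun s hs =>
    hroot (hA s ⟨hs.1.le, hs.2⟩)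
  have hIa' : ∀ s ∈ Ioc 0 T, a' s ≤ A' ^ (1 / 2 : ℝ) := fun s hs =>
    hroot (hA' s ⟨hs.1.le, hs.2⟩)
  have hAA : ∀ s ∈ Ioc 0 T, a s ^ 2 ≤ A := fun s hs => hA s ⟨hs.1.le, hs.2⟩
  have hAA' : ∀ s ∈ Ioc 0 T, a' s ^ 2 ≤ A' := fun s hs => hA' s ⟨hs.1.le, hs.2⟩
  have hT1 : ∫⁻ s in Ioc 0 T, a s * b s * a' s ^ 2 ≤ A ^ (1 / 2 : ℝ) * A' * (ENNReal.ofReal T * P) ^ (1 / 2 : ℝ) := by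
    calc ∫⁻ s in Ioc 0 T, a s * b s * a' s ^ 2 ≤ ∫⁻ s in Ioc 0 T, (A ^ (1 / 2 : ℝ) * A') * b s :=
          setLIntegral_mono' measurableSet_Ioc fun s hs => by
            calc a s * b s * a' s ^ 2 = a s * a' s ^ 2 * b s := by ring
              _ ≤ A ^ (1 / 2 : ℝ) * A' * b s := by gcongr; exacts [hIa s hs, hAA' s hs]
      _ = (A ^ (1 / 2 : ℝ) * A') * ∫⁻ s in Ioc 0 T, b s := lintegral_const_mul'' _ hbm
      _ ≤ (A ^ (1 / 2 : ℝ) * A') * (ENNReal.ofReal T * P) ^ (1 / 2 : ℝ) :=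
          mul_le_mul' le_rfl (setLIntegral_Ioc_le_rpow_half hbm hP)
      _ = _ := by ring
  have hT2 : ∫⁻ s in Ioc 0 T, a' s * b' s * a s ^ 2 ≤ A' ^ (1 / 2 : ℝ) * A * (ENNReal.ofReal T * P') ^ (1 / 2 : ℝ) := by
    calc ∫⁻ s in Ioc 0 T, a' s * b' s * a s ^ 2 ≤ ∫⁻ s in Ioc 0 T, (A' ^ (1 / 2 : ℝ) * A) * b' s :=
          setLIntegral_mono' measurableSet_Ioc fun s hs => by
            calc a' s * b' s * a s ^ 2 = a' s * a s ^ 2 * b' s := by ring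
              _ ≤ A' ^ (1 / 2 : ℝ) * A * b' s := by gcongr; exacts [hIa' s hs, hAA s hs]
      _ = (A' ^ (1 / 2 : ℝ) * A) * ∫⁻ s in Ioc 0 T, b' s := lintegral_const_mul'' _ hbm'
      _ ≤ (A' ^ (1 / 2 : ℝ) * A) * (ENNReal.ofReal T * P') ^ (1 / 2 : ℝ) :=
          mul_le_mul' le_rfl (setLIntegral_Ioc_le_rpow_half hbm' hP')
      _ = _ := by ring
  -- measurability of the first summand in time (for `lintegral_add_left'`)
  have ham : AEMeasurable a (volume.restrict (Ioc 0 T)) :=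
    aemeasurable_eLpNorm_weight_majorant hpj hwρ _ Measure.restrict_le_self
  have ham' : AEMeasurable a' (volume.restrict (Ioc 0 T)) :=
    aemeasurable_eLpNorm_weight_majorant hqj hwρ _ Measure.restrict_le_self
  rw [hswap]
  calc ∫⁻ s in Ioc 0 T, ∫⁻ ξ, ENNReal.ofReal (‖ξ‖ ^ 2) * φ s ξ ^ 2
      ≤ ∫⁻ s in Ioc 0 T, C ^ 2 * (2 * K3 ^ 2 * (a s * b s * a' s ^ 2 + a' s * b' s * a s ^ 2)) :=
        lintegral_mono fun s => hfix s
    _ = C ^ 2 * (2 * K3 ^ 2) * ((∫⁻ s in Ioc 0 T, a s * b s * a' s ^ 2) +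
          ∫⁻ s in Ioc 0 T, a' s * b' s * a s ^ 2) := by
        have hm1 : AEMeasurable (fun s => a s * b s * a' s ^ 2) (volume.restrict (Ioc 0 T)) :=
          (ham.mul hbm).mul (ham'.pow_const 2)
        have hm2 : AEMeasurable (fun s => a' s * b' s * a s ^ 2) (volume.restrict (Ioc 0 T)) :=
          (ham'.mul hbm').mul (ham.pow_const 2)
        rw [← lintegral_add_left' hm1,
          ← lintegral_const_mul'' (f := fun s => a s * b s * a' s ^ 2 + a' s * b' s * a s ^ 2) _
            (hm1.add hm2)]
        exact lintegral_congr fun s => by ring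
    _ ≤ C ^ 2 * (2 * K3 ^ 2) * (A ^ (1 / 2 : ℝ) * A' * (ENNReal.ofReal T * P) ^ (1 / 2 : ℝ) +
          A' ^ (1 / 2 : ℝ) * A * (ENNReal.ofReal T * P') ^ (1 / 2 : ℝ)) :=
        mul_le_mul' le_rfl (add_le_add hT1 hT2)
    _ = _ := by ring

/-- **The `X²` level of the bilinear bound.** For `L²`-continuous, jointly measurable
trajectories `p, q` on `ℝ³` with all weighted square moments finite, and bounds
`A ≥ ‖ρM_p(s)‖₂²`, `B ≥ ‖ρ²M_p(s)‖₂²` on `[0,T]`, `E ≥ ∫₀ᵀ‖ρ³M_p(s)‖₂²` (primed for `q`),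

  `∫ ‖ξ‖⁴ ∫⁻_{(0,T]} φ_ξ(s)² ds dξ ≤ 8C_N²K₃² (B^{1/2} A' (T·E)^{1/2} + B'^{1/2} A (T·E')^{1/2})`:

Tonelli, the symmetrised fixed-time bound `lintegral_norm_sq_mul_fconv_majorant_sq_le`,
`b(s) ≤ B^{1/2}`, `a'(s)² ≤ A'` and Cauchy–Schwarz in time `∫₀ᵀ e ≤ (T E)^{1/2}`. Linear in the
top-order quantities of each factor (the `X²` estimate with an `X¹`-size coefficient; Tao 2013,
proof of Thm. 5.1, "induction on `k`"). [cite: Tao2011, Lemma 2.1 (arXiv Lemma 23)] -/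
theorem lintegral_fourth_weight_Phi_le
    (hpm : ∀ s, AEStronglyMeasurable (p s) volume) (hqm : ∀ s, AEStronglyMeasurable (q s) volume)
    (hpj : AEStronglyMeasurable (uncurry p) (volume.prod volume))
    (hqj : AEStronglyMeasurable (uncurry q) (volume.prod volume))
    (hp2 : ∀ s j, MemLp (p s · j) 2 volume) (hq2 : ∀ s j, MemLp (q s · j) 2 volume)
    (hpc : ∀ j s₀, Tendsto (fun s => eLpNorm ((p s · j) - (p s₀ · j)) 2 volume) (𝓝 s₀) (𝓝 0))
    (hqc : ∀ j s₀, Tendsto (fun s => eLpNorm ((q s · j) - (q s₀ · j)) 2 volume) (𝓝 s₀) (𝓝 0))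
    (hpw : ∀ s (k : ℕ) j, ∫⁻ η, (ENNReal.ofReal ((1 + ‖η‖) ^ k) * ‖p s η j‖ₑ) ^ 2 < ⊤)
    (hqw : ∀ s (k : ℕ) j, ∫⁻ η, (ENNReal.ofReal ((1 + ‖η‖) ^ k) * ‖q s η j‖ₑ) ^ 2 < ⊤)
    {A A' B B' E E' : ℝ≥0∞}
    (hA : ∀ s ∈ Icc 0 T, eLpNorm (fun η : EuclideanSpace ℝ (Fin 3) =>
      ENNReal.ofReal ‖η‖ * ∑ j, ‖p s η j‖ₑ) 2 volume ^ 2 ≤ A)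
    (hA' : ∀ s ∈ Icc 0 T, eLpNorm (fun η : EuclideanSpace ℝ (Fin 3) =>
      ENNReal.ofReal ‖η‖ * ∑ j, ‖q s η j‖ₑ) 2 volume ^ 2 ≤ A')
    (hB : ∀ s ∈ Icc 0 T, eLpNorm (fun η : EuclideanSpace ℝ (Fin 3) =>
      ENNReal.ofReal (‖η‖ ^ 2) * ∑ j, ‖p s η j‖ₑ) 2 volume ^ 2 ≤ B)
    (hB' : ∀ s ∈ Icc 0 T, eLpNorm (fun η : EuclideanSpace ℝ (Fin 3) =>
      ENNReal.ofReal (‖η‖ ^ 2) * ∑ j, ‖q s η j‖ₑ) 2 volume ^ 2 ≤ B')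
    (hE : ∫⁻ s in Ioc 0 T, eLpNorm (fun η : EuclideanSpace ℝ (Fin 3) =>
      ENNReal.ofReal (‖η‖ ^ 3) * ∑ j, ‖p s η j‖ₑ) 2 volume ^ 2 ≤ E)
    (hE' : ∫⁻ s in Ioc 0 T, eLpNorm (fun η : EuclideanSpace ℝ (Fin 3) =>
      ENNReal.ofReal (‖η‖ ^ 3) * ∑ j, ‖q s η j‖ₑ) 2 volume ^ 2 ≤ E') :
    ∫⁻ ξ, ENNReal.ofReal (‖ξ‖ ^ 4) * ∫⁻ s in Ioc 0 T, (ENNReal.ofReal (4 * π) *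
        (Fintype.card (Fin 3) : ℝ≥0∞) ^ 2 * ‖fconv (fun η => ((∑ j, ‖p s η j‖ : ℝ) : ℂ))
          (fun η => ((∑ j, ‖q s η j‖ : ℝ) : ℂ)) ξ‖ₑ) ^ 2 ≤
      8 * (ENNReal.ofReal (4 * π) * (Fintype.card (Fin 3) : ℝ≥0∞) ^ 2) ^ 2 *
        ((SNormLESNormFDerivOfEqConst ℂ (volume : Measure (EuclideanSpace ℝ (Fin 3))) 2 *
          ENNReal.ofReal (2 * π)) ^ (3 / 2 : ℝ)) ^ 2 *
        (B ^ (1 / 2 : ℝ) * A' * (ENNReal.ofReal T * E) ^ (1 / 2 : ℝ) +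
          B' ^ (1 / 2 : ℝ) * A * (ENNReal.ofReal T * E') ^ (1 / 2 : ℝ)) := by
  set C : ℝ≥0∞ := ENNReal.ofReal (4 * π) * (Fintype.card (Fin 3) : ℝ≥0∞) ^ 2 with hC
  set K3 : ℝ≥0∞ := (SNormLESNormFDerivOfEqConst ℂ (volume : Measure (EuclideanSpace ℝ (Fin 3))) 2 *
    ENNReal.ofReal (2 * π)) ^ (3 / 2 : ℝ) with hK3
  have hCtop : C ≠ ⊤ := ENNReal.mul_ne_top ENNReal.ofReal_ne_top (by simp)
  -- the weighted norms as functions of time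
  set a : ℝ → ℝ≥0∞ := fun s => eLpNorm (fun η : EuclideanSpace ℝ (Fin 3) =>
    ENNReal.ofReal ‖η‖ * ∑ j, ‖p s η j‖ₑ) 2 volume with ha
  set b : ℝ → ℝ≥0∞ := fun s => eLpNorm (fun η : EuclideanSpace ℝ (Fin 3) =>
    ENNReal.ofReal (‖η‖ ^ 2) * ∑ j, ‖p s η j‖ₑ) 2 volume with hb
  set a' : ℝ → ℝ≥0∞ := fun s => eLpNorm (fun η : EuclideanSpace ℝ (Fin 3) =>
    ENNReal.ofReal ‖η‖ * ∑ j, ‖q s η j‖ₑ) 2 volume with ha'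
  set b' : ℝ → ℝ≥0∞ := fun s => eLpNorm (fun η : EuclideanSpace ℝ (Fin 3) =>
    ENNReal.ofReal (‖η‖ ^ 2) * ∑ j, ‖q s η j‖ₑ) 2 volume with hb'
  set e : ℝ → ℝ≥0∞ := fun s => eLpNorm (fun η : EuclideanSpace ℝ (Fin 3) =>
    ENNReal.ofReal (‖η‖ ^ 3) * ∑ j, ‖p s η j‖ₑ) 2 volume with he
  set e' : ℝ → ℝ≥0∞ := fun s => eLpNorm (fun η : EuclideanSpace ℝ (Fin 3) =>
    ENNReal.ofReal (‖η‖ ^ 3) * ∑ j, ‖q s η j‖ₑ) 2 volume with he'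
  have hwρ : Measurable fun η : EuclideanSpace ℝ (Fin 3) => ENNReal.ofReal ‖η‖ :=
    (ENNReal.continuous_ofReal.comp continuous_norm).measurable
  have hwρ2 : Measurable fun η : EuclideanSpace ℝ (Fin 3) => ENNReal.ofReal (‖η‖ ^ 2) :=
    (ENNReal.continuous_ofReal.comp (continuous_norm.pow 2)).measurable
  have hwρ3 : Measurable fun η : EuclideanSpace ℝ (Fin 3) => ENNReal.ofReal (‖η‖ ^ 3) :=
    (ENNReal.continuous_ofReal.comp (continuous_norm.pow 3)).measurable
  have hwρ4 : Measurable fun η : EuclideanSpace ℝ (Fin 3) => ENNReal.ofReal (‖η‖ ^ 4) :=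
    (ENNReal.continuous_ofReal.comp (continuous_norm.pow 4)).measurable
  have hbm : AEMeasurable b (volume.restrict (Ioc 0 T)) :=
    aemeasurable_eLpNorm_weight_majorant hpj hwρ2 _ Measure.restrict_le_self
  have hbm' : AEMeasurable b' (volume.restrict (Ioc 0 T)) :=
    aemeasurable_eLpNorm_weight_majorant hqj hwρ2 _ Measure.restrict_le_self
  have hem : AEMeasurable e (volume.restrict (Ioc 0 T)) :=
    aemeasurable_eLpNorm_weight_majorant hpj hwρ3 _ Measure.restrict_le_self
  have hem' : AEMeasurable e' (volume.restrict (Ioc 0 T)) :=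
    aemeasurable_eLpNorm_weight_majorant hqj hwρ3 _ Measure.restrict_le_self
  -- the integrand `(s, ξ) ↦ ρ² φ²`
  set φ : ℝ → EuclideanSpace ℝ (Fin 3) → ℝ≥0∞ := fun s ξ => C * ‖fconv
    (fun η => ((∑ j, ‖p s η j‖ : ℝ) : ℂ)) (fun η => ((∑ j, ‖q s η j‖ : ℝ) : ℂ)) ξ‖ₑ with hφ
  have hφm : Measurable (uncurry φ) := measurable_phi hpm hqm hp2 hq2 hpc hqc C
  -- Step 1: Tonelli
  have hswap : ∫⁻ ξ, ENNReal.ofReal (‖ξ‖ ^ 4) * ∫⁻ s in Ioc 0 T, φ s ξ ^ 2 =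
      ∫⁻ s in Ioc 0 T, ∫⁻ ξ, ENNReal.ofReal (‖ξ‖ ^ 4) * φ s ξ ^ 2 := by
    calc ∫⁻ ξ, ENNReal.ofReal (‖ξ‖ ^ 4) * ∫⁻ s in Ioc 0 T, φ s ξ ^ 2
        = ∫⁻ ξ, ∫⁻ s in Ioc 0 T, ENNReal.ofReal (‖ξ‖ ^ 4) * φ s ξ ^ 2 :=
          lintegral_congr fun ξ => (lintegral_const_mul' _ _ ENNReal.ofReal_ne_top).symm
      _ = ∫⁻ s in Ioc 0 T, ∫⁻ ξ, ENNReal.ofReal (‖ξ‖ ^ 4) * φ s ξ ^ 2 := by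
          refine lintegral_lintegral_swap ?_
          have h1 : Measurable fun z : EuclideanSpace ℝ (Fin 3) × ℝ =>
              ENNReal.ofReal (‖z.1‖ ^ 4) * φ z.2 z.1 ^ 2 :=
            (hwρ4.comp measurable_fst).mul ((hφm.comp measurable_swap).pow_const 2)
          exact h1.aemeasurable
  -- Step 2: the fixed-time bound
  have hfix : ∀ s, ∫⁻ ξ, ENNReal.ofReal (‖ξ‖ ^ 4) * φ s ξ ^ 2 ≤
      C ^ 2 * (8 * K3 ^ 2 * (b s * e s * a' s ^ 2 + b' s * e' s * a s ^ 2)) := by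
    intro s
    have h := lintegral_norm_sq_mul_fconv_majorant_sq_le (hpm s) (hqm s) (hp2 s) (hq2 s) (hpw s) (hqw s)
    calc ∫⁻ ξ, ENNReal.ofReal (‖ξ‖ ^ 4) * φ s ξ ^ 2
        = C ^ 2 * ∫⁻ ξ, (ENNReal.ofReal (‖ξ‖ ^ 2) * ‖fconv (fun η => ((∑ j, ‖p s η j‖ : ℝ) : ℂ))
            (fun η => ((∑ j, ‖q s η j‖ : ℝ) : ℂ)) ξ‖ₑ) ^ 2 := by
          rw [← lintegral_const_mul' _ _ (by simp [hCtop])]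
          refine lintegral_congr fun ξ => ?_
          rw [hφ]; simp only
          rw [show (4 : ℕ) = 2 * 2 from rfl, pow_mul, ENNReal.ofReal_pow (by positivity)]; ring
      _ ≤ C ^ 2 * (8 * K3 ^ 2 * (b s * e s * a' s ^ 2 + b' s * e' s * a s ^ 2)) :=
          mul_le_mul' le_rfl h
  -- Step 3: integrate in time
  have hroot : ∀ {x A : ℝ≥0∞}, x ^ 2 ≤ A → x ≤ A ^ (1 / 2 : ℝ) := fun {x A} h =>
    calc x = (x ^ 2) ^ (1 / 2 : ℝ) := by rw [← ENNReal.rpow_natCast, ← ENNReal.rpow_mul]; norm_num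
      _ ≤ A ^ (1 / 2 : ℝ) := ENNReal.rpow_le_rpow h (by norm_num)
  have hIa : ∀ s ∈ Ioc 0 T, a s ≤ A ^ (1 / 2 : ℝ) := fun s hs =>
    hroot (hA s ⟨hs.1.le, hs.2⟩)
  have hIa' : ∀ s ∈ Ioc 0 T, a' s ≤ A' ^ (1 / 2 : ℝ) := fun s hs =>
    hroot (hA' s ⟨hs.1.le, hs.2⟩)
  have hAA : ∀ s ∈ Ioc 0 T, a s ^ 2 ≤ A := fun s hs => hA s ⟨hs.1.le, hs.2⟩
  have hAA' : ∀ s ∈ Ioc 0 T, a' s ^ 2 ≤ A' := fun s hs => hA' s ⟨hs.1.le, hs.2⟩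
  have hIb : ∀ s ∈ Ioc 0 T, b s ≤ B ^ (1 / 2 : ℝ) := fun s hs =>
    hroot (hB s ⟨hs.1.le, hs.2⟩)
  have hIb' : ∀ s ∈ Ioc 0 T, b' s ≤ B' ^ (1 / 2 : ℝ) := fun s hs =>
    hroot (hB' s ⟨hs.1.le, hs.2⟩)
  have hT1 : ∫⁻ s in Ioc 0 T, b s * e s * a' s ^ 2 ≤ B ^ (1 / 2 : ℝ) * A' * (ENNReal.ofReal T * E) ^ (1 / 2 : ℝ) := by
    calc ∫⁻ s in Ioc 0 T, b s * e s * a' s ^ 2 ≤ ∫⁻ s in Ioc 0 T, (B ^ (1 / 2 : ℝ) * A') * e s :=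
          setLIntegral_mono' measurableSet_Ioc fun s hs => by
            calc b s * e s * a' s ^ 2 = b s * a' s ^ 2 * e s := by ring
              _ ≤ B ^ (1 / 2 : ℝ) * A' * e s := by gcongr; exacts [hIb s hs, hAA' s hs]
      _ = (B ^ (1 / 2 : ℝ) * A') * ∫⁻ s in Ioc 0 T, e s := lintegral_const_mul'' _ hem
      _ ≤ (B ^ (1 / 2 : ℝ) * A') * (ENNReal.ofReal T * E) ^ (1 / 2 : ℝ) :=
          mul_le_mul' le_rfl (setLIntegral_Ioc_le_rpow_half hem hE)
      _ = _ := by ring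
  have hT2 : ∫⁻ s in Ioc 0 T, b' s * e' s * a s ^ 2 ≤ B' ^ (1 / 2 : ℝ) * A * (ENNReal.ofReal T * E') ^ (1 / 2 : ℝ) := by
    calc ∫⁻ s in Ioc 0 T, b' s * e' s * a s ^ 2 ≤ ∫⁻ s in Ioc 0 T, (B' ^ (1 / 2 : ℝ) * A) * e' s :=
          setLIntegral_mono' measurableSet_Ioc fun s hs => by
            calc b' s * e' s * a s ^ 2 = b' s * a s ^ 2 * e' s := by ring
              _ ≤ B' ^ (1 / 2 : ℝ) * A * e' s := by gcongr; exacts [hIb' s hs, hAA s hs]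
      _ = (B' ^ (1 / 2 : ℝ) * A) * ∫⁻ s in Ioc 0 T, e' s := lintegral_const_mul'' _ hem'
      _ ≤ (B' ^ (1 / 2 : ℝ) * A) * (ENNReal.ofReal T * E') ^ (1 / 2 : ℝ) :=
          mul_le_mul' le_rfl (setLIntegral_Ioc_le_rpow_half hem' hE')
      _ = _ := by ring
  -- measurability of the first summand in time (for `lintegral_add_left'`)
  have ham : AEMeasurable a (volume.restrict (Ioc 0 T)) :=
    aemeasurable_eLpNorm_weight_majorant hpj hwρ _ Measure.restrict_le_self
  have ham' : AEMeasurable a' (volume.restrict (Ioc 0 T)) :=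
    aemeasurable_eLpNorm_weight_majorant hqj hwρ _ Measure.restrict_le_self
  rw [hswap]
  calc ∫⁻ s in Ioc 0 T, ∫⁻ ξ, ENNReal.ofReal (‖ξ‖ ^ 4) * φ s ξ ^ 2
      ≤ ∫⁻ s in Ioc 0 T, C ^ 2 * (8 * K3 ^ 2 * (b s * e s * a' s ^ 2 + b' s * e' s * a s ^ 2)) :=
        lintegral_mono fun s => hfix s
    _ = C ^ 2 * (8 * K3 ^ 2) * ((∫⁻ s in Ioc 0 T, b s * e s * a' s ^ 2) +
          ∫⁻ s in Ioc 0 T, b' s * e' s * a s ^ 2) := by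
        have hm1 : AEMeasurable (fun s => b s * e s * a' s ^ 2) (volume.restrict (Ioc 0 T)) :=
          (hbm.mul hem).mul (ham'.pow_const 2)
        have hm2 : AEMeasurable (fun s => b' s * e' s * a s ^ 2) (volume.restrict (Ioc 0 T)) :=
          (hbm'.mul hem').mul (ham.pow_const 2)
        rw [← lintegral_add_left' hm1,
          ← lintegral_const_mul'' (f := fun s => b s * e s * a' s ^ 2 + b' s * e' s * a s ^ 2) _
            (hm1.add hm2)]
        exact lintegral_congr fun s => by ring
    _ ≤ C ^ 2 * (8 * K3 ^ 2) * (B ^ (1 / 2 : ℝ) * A' * (ENNReal.ofReal T * E) ^ (1 / 2 : ℝ) +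
          B' ^ (1 / 2 : ℝ) * A * (ENNReal.ofReal T * E') ^ (1 / 2 : ℝ)) :=
        mul_le_mul' le_rfl (add_le_add hT1 hT2)
    _ = _ := by ring

end Integrated

end Literature.Analysis.FluidPDE.FourierNS

end
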